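import Summits.PneNP.PneNP.Theorems.KarlinRubinMonotoneBlindSwitchCode

/-!
# Route KarlinRubin, crux `MonotoneBlind` (stmt-PneNP-18027): clique-restriction switching — completeness of the code

Companion of `KarlinRubinMonotoneBlindSwitchCode.lean` (seat write-up `MonotoneBlind_AC0_announce.md`):

* `exists_code_of_swRun` — **completeness**: if the canonical run (`swRun`) of some inside assignment queries slots
  meeting `≥ v₀` vertices and every pending clause is small (`≤ P` slots, `≤ r` inside the sub-universe), then some code
  of length `≤ C(v₀-1,2) + 1` makes the forward process `swFwd` succeed (the code is read off the run: per stage, the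
  new inside slots of the examined clause and the black ones among them; each non-final stage queries a new slot among
  `< v₀` revealed vertices, whence the length bound).

All `--supports stmt-PneNP-18027`; no definitions.
-/

set_option linter.dupNamespace false -- `Summit.PneNP.PneNP.…`: summit = sub-problem (D-0017)

namespace Summit.PneNP.PneNP.Theorems

open Finset
open Literature.Computability.Complexity
open Literature.Probability.RandomGraphs.PlantedClique

variable {n : ℕ}

variable (V : Finset (Fin n)) (x : EdgeVec n) (P r v₀ : ℕ)

/-! ### Completeness: a long canonical run yields a successful code -/

open Classical in
/-- **Completeness.** If the canonical run of `z` from the state `K` (inside `V`, slots of `K` inside `Z = V(K)`,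
`#Z < v₀`, blacks of `K` recorded in `B`) queries slots meeting `≥ v₀` vertices, and every pending clause of `l` has
`≤ P` slots of which `≤ r` inside `V`, then some code of length `≤ C(v₀-1,2) + 1 - #K` makes the forward process
succeed from that state. [cite: Beame1994, §3] -/
theorem exists_code_of_swRun (z : EdgeVec n) :
    ∀ (l : List (Finset (⊤ : SimpleGraph (Fin n)).edgeSet)) (K : Finset (⊤ : SimpleGraph (Fin n)).edgeSet)
      (Z : Finset (Fin n)),
      (∀ S ∈ l, (∀ e ∈ S, (¬ ∀ v ∈ (e : Sym2 (Fin n)), v ∈ V) → x e = false) →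
        #S ≤ P ∧ #(S.filter fun e : (⊤ : SimpleGraph (Fin n)).edgeSet => ∀ v ∈ (e : Sym2 (Fin n)), v ∈ V) ≤ r) →
      (∀ e ∈ K, ∀ v ∈ (e : Sym2 (Fin n)), v ∈ V) →
      (Z = univ.filter fun v : Fin n => ∃ e ∈ K, v ∈ (e : Sym2 (Fin n))) → #Z < v₀ →
      v₀ ≤ #(univ.filter fun v : Fin n => ∃ e ∈ (swRun V x z l K).2, v ∈ (e : Sym2 (Fin n))) →
      ∃ code : List (Finset (⊤ : SimpleGraph (Fin n)).edgeSet × Finset (⊤ : SimpleGraph (Fin n)).edgeSet),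
        code.length + #K ≤ (v₀ - 1).choose 2 + 1 ∧
        (swFwd V x P r v₀ code l K (K.filter fun e => z e = true) Z).isSome = true := by
  intro l
  induction l with
  | nil =>
    intro K Z _ _ hZ hZlt hbad
    rw [swRun_nil] at hbad
    rw [← hZ] at hbad
    omega
  | cons S l ih =>
    intro K Z hsmall hKin hZ hZlt hbad
    have hsmall' : ∀ S ∈ l, (∀ e ∈ S, (¬ ∀ v ∈ (e : Sym2 (Fin n)), v ∈ V) → x e = false) →
        #S ≤ P ∧ #(S.filter fun e : (⊤ : SimpleGraph (Fin n)).edgeSet => ∀ v ∈ (e : Sym2 (Fin n)), v ∈ V) ≤ r :=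
      fun T hT => hsmall T (List.mem_cons_of_mem _ hT)
    rw [swRun_cons] at hbad
    by_cases h1 : ∃ e ∈ S, (¬ ∀ v ∈ (e : Sym2 (Fin n)), v ∈ V) ∧ x e = true
    · rw [if_pos h1] at hbad
      obtain ⟨code, hlen, hsome⟩ := ih K Z hsmall' hKin hZ hZlt hbad
      refine ⟨code, hlen, ?_⟩
      rw [swFwd_cons, if_pos h1]
      exact hsome
    rw [if_neg h1] at hbad
    have h2iff : (∃ e ∈ S, (∀ v ∈ (e : Sym2 (Fin n)), v ∈ V) ∧ e ∈ K ∧ z e = true) ↔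
        ∃ e ∈ S, e ∈ K.filter fun e => z e = true := by
      constructor
      · rintro ⟨e, he, -, heK, hze⟩
        exact ⟨e, he, mem_filter.2 ⟨heK, hze⟩⟩
      · rintro ⟨e, he, heK⟩
        rw [mem_filter] at heK
        exact ⟨e, he, hKin e heK.1, heK.1, heK.2⟩
    by_cases h2 : ∃ e ∈ S, (∀ v ∈ (e : Sym2 (Fin n)), v ∈ V) ∧ e ∈ K ∧ z e = true
    · rw [if_pos h2] at hbad
      obtain ⟨code, hlen, hsome⟩ := ih K Z hsmall' hKin hZ hZlt hbad
      refine ⟨code, hlen, ?_⟩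
      rw [swFwd_cons, if_neg h1, if_pos (h2iff.1 h2)]
      exact hsome
    rw [if_neg h2] at hbad
    -- a stage: the clause is pending
    have hpend : ∀ e ∈ S, (¬ ∀ v ∈ (e : Sym2 (Fin n)), v ∈ V) → x e = false := by
      intro e he he1
      cases hxe : x e
      · rfl
      · exact absurd ⟨e, he, he1, hxe⟩ h1
    obtain ⟨hSP, hSr⟩ := hsmall S List.mem_cons_self hpend
    set hS := S.filter (fun e : (⊤ : SimpleGraph (Fin n)).edgeSet => ∀ v ∈ (e : Sym2 (Fin n)), v ∈ V) with hhS
    set nw := hS \ K with hnw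
    set bk := nw.filter (fun e => z e = true) with hbk
    set Z' := Z ∪ univ.filter fun v : Fin n => ∃ e ∈ nw, v ∈ (e : Sym2 (Fin n)) with hZ'
    have hKnw : K ∪ hS = K ∪ nw := by rw [hnw, union_sdiff_self_eq_union]
    have hnwr : #nw ≤ r := (card_le_card sdiff_subset).trans hSr
    have hcheck : nw = (S.filter fun e : (⊤ : SimpleGraph (Fin n)).edgeSet => ∀ v ∈ (e : Sym2 (Fin n)), v ∈ V) \ K ∧ bk ⊆ nw ∧ #S ≤ P ∧ #nw ≤ r :=
      ⟨rfl, filter_subset _ _, hSP, hnwr⟩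
    have hZ'eq : Z' = univ.filter fun v : Fin n => ∃ e ∈ K ∪ nw, v ∈ (e : Sym2 (Fin n)) := by
      ext v
      simp only [hZ', hZ, mem_union, mem_filter, mem_univ, true_and]
      constructor
      · rintro (⟨e, he, hv⟩ | ⟨e, he, hv⟩)
        · exact ⟨e, Or.inl he, hv⟩
        · exact ⟨e, Or.inr he, hv⟩
      · rintro ⟨e, he | he, hv⟩
        · exact Or.inl ⟨e, he, hv⟩
        · exact Or.inr ⟨e, he, hv⟩
    have hB' : (K.filter fun e => z e = true) ∪ bk = (K ∪ nw).filter fun e => z e = true := by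
      rw [hbk, filter_union]
    have hK'in : ∀ e ∈ K ∪ nw, ∀ v ∈ (e : Sym2 (Fin n)), v ∈ V := by
      intro e he
      rcases mem_union.1 he with he | he
      · exact hKin e he
      · rw [hnw, mem_sdiff, hhS, mem_filter] at he
        exact he.1.2
    by_cases h4 : v₀ ≤ #Z'
    · -- success now
      refine ⟨[(nw, bk)], ?_, ?_⟩
      · have hKcard : #K ≤ (v₀ - 1).choose 2 := by
          refine (card_le_choose_two_of_inside Z K fun e he v hv => ?_).trans (Nat.choose_le_choose 2 (by omega))
          rw [hZ]
          exact mem_filter.2 ⟨mem_univ _, e, he, hv⟩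
        simp only [List.length_singleton]
        omega
      · rw [swFwd_cons, if_neg h1, if_neg (fun h => h2 (h2iff.2 h))]
        simp only
        rw [if_pos hcheck, if_pos h4]
        simp
    · -- the stage is not all white (else the run would end here with `< v₀` vertices), continue
      by_cases h3 : ∀ e ∈ S, (∀ v ∈ (e : Sym2 (Fin n)), v ∈ V) → z e = false
      · rw [if_pos h3] at hbad
        exfalso
        have hbad' : v₀ ≤ #Z' := by
          rw [hZ'eq, ← hKnw]
          exact hbad
        exact h4 hbad'
      rw [if_neg h3] at hbad
      rw [hKnw] at hbad
      have hbkne : bk ≠ ∅ := by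
        intro hbke
        refine h3 fun e he he1 => ?_
        by_cases heK : e ∈ K
        · cases hze : z e
          · rfl
          · exact absurd ⟨e, he, he1, heK, hze⟩ h2
        · have henw : e ∈ nw := by
            rw [hnw, mem_sdiff, hhS, mem_filter]
            exact ⟨⟨he, he1⟩, heK⟩
          cases hze : z e
          · rfl
          · have : e ∈ bk := mem_filter.2 ⟨henw, hze⟩
            rw [hbke] at this
            simp at this
      have hlt' : #Z' < v₀ := not_le.1 h4
      obtain ⟨code', hlen', hsome'⟩ := ih (K ∪ nw) Z' hsmall' hK'in hZ'eq hlt' hbad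
      refine ⟨(nw, bk) :: code', ?_, ?_⟩
      · -- the new slots are new and nonempty: `#K + 1 ≤ #(K ∪ nw) ≤ C(v₀-1,2)`
        have hne : nw.Nonempty := by
          rw [nonempty_iff_ne_empty]
          intro hnwe
          apply hbkne
          rw [hbk, hnwe, filter_empty]
        have hdisj : Disjoint K nw := by rw [hnw]; exact disjoint_sdiff
        have hcardK' : #(K ∪ nw) = #K + #nw := card_union_of_disjoint hdisj
        have hK'card : #(K ∪ nw) ≤ (v₀ - 1).choose 2 := by
          refine (card_le_choose_two_of_inside Z' (K ∪ nw) fun e he v hv => ?_).trans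
            (Nat.choose_le_choose 2 (by omega))
          rw [hZ'eq]
          exact mem_filter.2 ⟨mem_univ _, e, he, hv⟩
        have hpos : 0 < #nw := card_pos.2 hne
        simp only [List.length_cons]
        omega
      · rw [swFwd_cons, if_neg h1, if_neg (fun h => h2 (h2iff.2 h))]
        simp only
        rw [if_pos hcheck, if_neg h4, if_neg hbkne, hB']
        exact hsome'


/-- Registered stub `stub_switchComplete` of the clique-restriction switching line (the length bookkeeping of the
completeness proof: a stage with a nonempty set of new slots disjoint from the queried ones increases the queried set).
[folklore] -/
theorem stub_switchComplete :
    ∀ (n : ℕ) (K nw : Finset ((⊤ : SimpleGraph (Fin n)).edgeSet)), Disjoint K nw → nw.Nonempty →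
      K.card + 1 ≤ (K ∪ nw).card := by
  intro n K nw hdisj hne
  rw [Finset.card_union_of_disjoint hdisj]
  have := Finset.card_pos.2 hne
  omega

end Summit.PneNP.PneNP.Theorems
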